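import Summits.AtomisticToContinuum.Crystallization.Theorems.PalmUnimodularRigidityShellsToBarlowChartTransportComm3
import Summits.AtomisticToContinuum.Crystallization.Theorems.PalmUnimodularRigidityShellsToBarlowChartTransportVComm3
import Summits.AtomisticToContinuum.Crystallization.Theorems.PalmUnimodularRigidityShellsToBarlowChartTransportLayerZero

/-!
# Combinatorial layering (B1a of `GapTwelveToBarlow`): graded chart API for the transport port (part 1)

Crux `SquareWellLayerCake.GapTwelveToBarlow` (stmt-AtomisticToContinuum-15807), line `Sketch`,
stub `stub_combinatorialLayering`, residual `(H_develop)`: finite development of a window from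
COMBINATORIAL integer charts (`…CombinatorialLayeringCharts`) that TRANSFER
(`…CombinatorialLayeringTransfer`).  This file starts the PORT of the tree's transport machinery
(`PalmUnimodularRigidityShellsToBarlowChartTransport{Steps1–7,Lower,Vinv,Attach*,Comm*,VComm*,
LayerZero}`, crux 9227) to that setting.  It is a port of `…TransportSteps1` with THREE changes,
followed by the later parts file by file:

* the standing hypothesis `hch : ∀ z ∈ S, IsZChart S z …` (metric charts at every point of an
  infinite `S`) becomes ONE bundled hypothesis `hch` (kept under the same name, so that call
  sites port verbatim) on GRADED data: a family `S : ℕ → Set E3` of charted sites (level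
  `n + 1` sites have all their bonded neighbours at level `n`: a finite window has uncharted
  boundary, so depth must be tracked), an abstract symmetric bond relation
  `B : E3 → E3 → Prop`, patterns `Pc` and labellings `nb` — with conjuncts CHART (pattern is
  `fcc3Int` or `hcpInt`, `nb z` maps `Pc z` bijectively onto `{y | B z y}`, bonds among labelled
  neighbours ↔ label pairs at squared distance `18`), CLOSURE, TRANSFER (the conclusion of the
  tree's metric `sqNormInt_transfer`, here an INPUT: it is `transfer_of_zcharts`) and SYMMETRY;
* a bond `0 < dist a b ∧ dist a b ≤ 28/25` (hypothesis, conclusion or set-builder) becomes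
  `B a b`; memberships `x ∈ S` become `x ∈ S (n + k)` with `k` the chart depth the lemma uses
  below `x` (so `nb_mem` lands one level down), `n` arbitrary;
* `bond_symm h` becomes `bond_symm hch h`; `(hch x hx).sqNormInt_eq ht` becomes
  `chart_sqNormInt_eq hch hx ht`; `zlab_spec hch hy hz hb` keeps the (now redundant) `hz`.

The frame operations (`ZFrame, zlab, Istep, …, frameAt` of `…TransportOpsDefs`), the pattern
facts (`…TransportPatterns1–14`) and ALL chart-agnostic lemmas of the source parts
(`mem_hexLabels_iff`, `apexOf_eq_of_form`, `hexLabels_comm`, the `…_swap` lemmas, …) are IMPORTED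
from the tree (this file imports the three leaves `…TransportComm3 / VComm3 / LayerZero` of the
9227 chain, so every later part sees them), never restated; only the chart-dependent lemmas are
ported, under the names of the source (our namespace; the `open … hiding` line hides ALL the 9227
chart-dependent names — copy it verbatim into every later part).  All `[folklore]`.
-/

noncomputable section

namespace Summit.AtomisticToContinuum.Crystallization.Theorems.SquareWellLayerCakeGapTwelveToBarlow

open Literature.Geometry.DiscreteGeometry Literature.MathematicalPhysics.StatisticalMechanics
open Summit.AtomisticToContinuum.Crystallization.Theorems.PalmUnimodularRigidityShellsToBarlowChart hiding
  IsZChart TransportSystem scales_tied sqNormInt_transfer bond_symm nb_mem zlab_spec zlab_nb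
  bond_nb_iff pattern_cases transfer_nb_nb transfer_nb_centre transfer_nb_target
  sqNormInt_zlab_centre hcp_of_mirror_pair Istep_spec Jstep_spec IinvStep_spec JinvStep_spec
  capWithAny_of_mem_cap IinvStep_Istep Istep_IinvStep JinvStep_Jstep Jstep_JinvStep polar_at_apex
  onesided_at_apex Vstep_spec nb_inj Istep_lower Jstep_lower IinvStep_lower JinvStep_lower
  polar_at_lower_apex onesided_at_lower_apex VinvStep_spec attach_I_even attach_I_odd
  attach_lower_I_pos attach_lower_I_neg attach_J_even attach_J_odd Vstep_Istep_pt Vstep_Istep_back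
  Vstep_Istep_side Vstep_Jstep_pt Vstep_Istep_comm Vstep_Jstep_comm attach_lower_J_pos
  attach_lower_J_neg VinvStep_Istep_pt VinvStep_Jstep_pt VinvStep_Istep_back VinvStep_Istep_side
  VinvStep_Istep_comm VinvStep_Jstep_comm Istep_Jstep_comm

variable {S : ℕ → Set (EuclideanSpace ℝ (Fin 3))}
  {B : EuclideanSpace ℝ (Fin 3) → EuclideanSpace ℝ (Fin 3) → Prop}
  {Pc : EuclideanSpace ℝ (Fin 3) → Finset (Fin 3 → ℤ)}
  {nb : EuclideanSpace ℝ (Fin 3) → (Fin 3 → ℤ) → EuclideanSpace ℝ (Fin 3)}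

variable
  (hch : (∀ n : ℕ, ∀ z ∈ S n, (Pc z = fcc3Int ∨ Pc z = hcpInt) ∧
      Set.BijOn (nb z) (↑(Pc z) : Set (Fin 3 → ℤ)) {y | B z y} ∧
      ∀ t ∈ Pc z, ∀ t' ∈ Pc z, (B (nb z t) (nb z t') ↔ sqNormInt (t - t') = 18)) ∧
    (∀ n : ℕ, ∀ z ∈ S (n + 1), ∀ y, B z y → y ∈ S n) ∧
    (∀ n m : ℕ, ∀ x ∈ S n, ∀ y ∈ S m, B x y →
      ∀ (z z' : EuclideanSpace ℝ (Fin 3)) (t t' u u' : Fin 3 → ℤ),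
        (t = 0 ∧ z = x ∨ t ∈ Pc x ∧ z = nb x t) → (t' = 0 ∧ z' = x ∨ t' ∈ Pc x ∧ z' = nb x t') →
        (u = 0 ∧ z = y ∨ u ∈ Pc y ∧ z = nb y u) → (u' = 0 ∧ z' = y ∨ u' ∈ Pc y ∧ z' = nb y u') →
        sqNormInt (u - u') = sqNormInt (t - t')) ∧
    (∀ x y, B x y → B y x))

include hch

/-! ## Chart API -/

/-- The bond relation is symmetric. [folklore] -/
theorem bond_symm {x y : EuclideanSpace ℝ (Fin 3)} (h : B x y) : B y x := hch.2.2.2 x y h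

/-- A labelled neighbour of a level-`n + 1` site is a level-`n` site bonded to the centre.
[folklore] -/
theorem nb_mem {n : ℕ} {x : EuclideanSpace ℝ (Fin 3)} (hx : x ∈ S (n + 1))
    {t : Fin 3 → ℤ} (ht : t ∈ Pc x) : nb x t ∈ S n ∧ B x (nb x t) :=
  have hb : B x (nb x t) := (hch.1 (n + 1) x hx).2.1.mapsTo ht
  ⟨hch.2.1 n x hx _ hb, hb⟩

/-- A labelled neighbour of a charted site is bonded to the centre (any level). [folklore] -/
theorem nb_bond {n : ℕ} {x : EuclideanSpace ℝ (Fin 3)} (hx : x ∈ S n)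
    {t : Fin 3 → ℤ} (ht : t ∈ Pc x) : B x (nb x t) :=
  (hch.1 n x hx).2.1.mapsTo ht

/-- The inverse labelling of a bonded neighbour is a label and labels it.  (The membership `hz`
of the target is redundant here — the bond carries it — and is kept so that call sites port
verbatim from the source.) [folklore] -/
theorem zlab_spec {n m : ℕ} {y z : EuclideanSpace ℝ (Fin 3)} (hy : y ∈ S n) (hz : z ∈ S m)
    (hb : B y z) : zlab Pc nb y z ∈ Pc y ∧ nb y (zlab Pc nb y z) = z := by
  obtain ⟨t, ht, htz⟩ := (hch.1 n y hy).2.1.surjOn ((fun _ : z ∈ S m => hb) hz)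
  have hex : ∃ t ∈ (↑(Pc y) : Set (Fin 3 → ℤ)), nb y t = z := ⟨t, ht, htz⟩
  exact ⟨Function.invFunOn_mem hex, Function.invFunOn_eq hex⟩

/-- The inverse labelling inverts the labelling on labels. [folklore] -/
theorem zlab_nb {n : ℕ} {y : EuclideanSpace ℝ (Fin 3)} (hy : y ∈ S n)
    {t : Fin 3 → ℤ} (ht : t ∈ Pc y) : zlab Pc nb y (nb y t) = t :=
  (hch.1 n y hy).2.1.invOn_invFunOn.1 ht

/-- The labelling is injective on the pattern. [folklore] -/
theorem nb_injOn {n : ℕ} {y : EuclideanSpace ℝ (Fin 3)} (hy : y ∈ S n) :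
    Set.InjOn (nb y) (↑(Pc y) : Set (Fin 3 → ℤ)) :=
  (hch.1 n y hy).2.1.injOn

/-- Bonds among labelled neighbours are the label pairs at squared distance `18`. [folklore] -/
theorem bond_nb_iff {n : ℕ} {x : EuclideanSpace ℝ (Fin 3)} (hx : x ∈ S n)
    {t t' : Fin 3 → ℤ} (ht : t ∈ Pc x) (ht' : t' ∈ Pc x) :
    B (nb x t) (nb x t') ↔ sqNormInt (t - t') = 18 :=
  (hch.1 n x hx).2.2 t ht t' ht'

/-- The pattern of a chart is FCC or HCP. [folklore] -/
theorem pattern_cases {n : ℕ} {x : EuclideanSpace ℝ (Fin 3)} (hx : x ∈ S n) :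
    Pc x = fcc3Int ∨ Pc x = hcpInt := (hch.1 n x hx).1

/-- Labels of a chart have squared norm `18` (the tree's `IsZChart.sqNormInt_eq`). [folklore] -/
theorem chart_sqNormInt_eq {n : ℕ} {x : EuclideanSpace ℝ (Fin 3)} (hx : x ∈ S n)
    {t : Fin 3 → ℤ} (ht : t ∈ Pc x) : sqNormInt t = 18 := by
  rcases pattern_cases hch hx with h | h
  · exact sqNormInt_of_mem_fcc3Int t (h ▸ ht)
  · exact sqNormInt_of_mem_hcpInt t (h ▸ ht)

/-- **The transfer input**, implicit-argument form: for two bonded charted sites `x, y` and two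
points each of which is `x` (label `0`) or a labelled neighbour of `x`, AND `y` or a labelled
neighbour of `y`, the squared label distance read at `y` is the one read at `x`. [folklore] -/
theorem chart_transfer {n m : ℕ} {x y : EuclideanSpace ℝ (Fin 3)} (hx : x ∈ S n) (hy : y ∈ S m)
    (hxy : B x y) {z z' : EuclideanSpace ℝ (Fin 3)} {t t' u u' : Fin 3 → ℤ}
    (hz : t = 0 ∧ z = x ∨ t ∈ Pc x ∧ z = nb x t) (hz' : t' = 0 ∧ z' = x ∨ t' ∈ Pc x ∧ z' = nb x t')
    (hu : u = 0 ∧ z = y ∨ u ∈ Pc y ∧ z = nb y u) (hu' : u' = 0 ∧ z' = y ∨ u' ∈ Pc y ∧ z' = nb y u') :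
    sqNormInt (u - u') = sqNormInt (t - t') :=
  hch.2.2.1 n m x hx y hy hxy z z' t t' u u' hz hz' hu hu'

/-- **Transfer for two labelled neighbours of `x`** that are also bonded neighbours of the bonded
site `y`: their squared label distance at `y` is the one at `x`. [folklore] -/
theorem transfer_nb_nb {n m : ℕ} {x y : EuclideanSpace ℝ (Fin 3)}
    (hx : x ∈ S (n + 1)) (hy : y ∈ S m) (hxy : B x y)
    {t t' : Fin 3 → ℤ} (ht : t ∈ Pc x) (ht' : t' ∈ Pc x)
    (hzt : B y (nb x t)) (hzt' : B y (nb x t')) :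
    sqNormInt (zlab Pc nb y (nb x t) - zlab Pc nb y (nb x t')) = sqNormInt (t - t') := by
  have h1 := zlab_spec hch hy (nb_mem hch hx ht).1 hzt
  have h2 := zlab_spec hch hy (nb_mem hch hx ht').1 hzt'
  exact chart_transfer hch hx hy hxy (Or.inr ⟨ht, rfl⟩) (Or.inr ⟨ht', rfl⟩)
    (Or.inr ⟨h1.1, h1.2.symm⟩) (Or.inr ⟨h2.1, h2.2.symm⟩)

/-- **Transfer for a labelled neighbour of `x` and `x` itself**, read at the bonded site `y`.
[folklore] -/
theorem transfer_nb_centre {n m : ℕ} {x y : EuclideanSpace ℝ (Fin 3)}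
    (hx : x ∈ S (n + 1)) (hy : y ∈ S m) (hxy : B x y)
    {t : Fin 3 → ℤ} (ht : t ∈ Pc x) (hzt : B y (nb x t)) :
    sqNormInt (zlab Pc nb y (nb x t) - zlab Pc nb y x) = sqNormInt t := by
  have h1 := zlab_spec hch hy (nb_mem hch hx ht).1 hzt
  have h2 := zlab_spec hch hy hx (bond_symm hch hxy)
  have := chart_transfer hch hx hy hxy (Or.inr ⟨ht, rfl⟩) (Or.inl ⟨rfl, rfl⟩)
    (Or.inr ⟨h1.1, h1.2.symm⟩) (Or.inr ⟨h2.1, h2.2.symm⟩)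
  rw [this, sub_zero]

/-- **Transfer for a labelled neighbour of `x` and `y` itself** (`y = nb x t₀`). [folklore] -/
theorem transfer_nb_target {n : ℕ} {x : EuclideanSpace ℝ (Fin 3)}
    (hx : x ∈ S (n + 1)) {t₀ t : Fin 3 → ℤ} (ht₀ : t₀ ∈ Pc x) (ht : t ∈ Pc x)
    (hzt : B (nb x t₀) (nb x t)) :
    sqNormInt (zlab Pc nb (nb x t₀) (nb x t)) = sqNormInt (t - t₀) := by
  have hy := nb_mem hch hx ht₀
  have h1 := zlab_spec hch hy.1 (nb_mem hch hx ht).1 hzt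
  have := chart_transfer hch hx hy.1 hy.2 (Or.inr ⟨ht, rfl⟩) (Or.inr ⟨ht₀, rfl⟩)
    (Or.inr ⟨h1.1, h1.2.symm⟩) (Or.inl ⟨rfl, rfl⟩)
  rw [sub_zero] at this
  exact this

/-- The label of the centre `x` at a labelled neighbour `y = nb x t₀` has squared norm `18`.
[folklore] -/
theorem sqNormInt_zlab_centre {n : ℕ} {x : EuclideanSpace ℝ (Fin 3)}
    (hx : x ∈ S (n + 1)) {t₀ : Fin 3 → ℤ} (ht₀ : t₀ ∈ Pc x) :
    sqNormInt (zlab Pc nb (nb x t₀) x) = 18 := by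
  have hy := nb_mem hch hx ht₀
  have h := zlab_spec hch hy.1 hx (bond_symm hch hy.2)
  exact chart_sqNormInt_eq hch hy.1 h.1

/-- **The mirror-pair argument** (regime B), graded form of the tree's lemma: two labelled
neighbours `u = nb x cu`, `l = nb x cl` of `x` with `sqNormInt (cu − cl) = 48`, both bonded to
the labelled neighbour `y = nb x t`, force `Pc y = hcpInt`, and a label at `y` touching both of
their labels is symmetric. [folklore] -/
theorem hcp_of_mirror_pair {n : ℕ} {x : EuclideanSpace ℝ (Fin 3)}
    (hx : x ∈ S (n + 1)) {t cu cl : Fin 3 → ℤ} (ht : t ∈ Pc x) (hcu : cu ∈ Pc x) (hcl : cl ∈ Pc x)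
    (h48 : sqNormInt (cu - cl) = 48)
    (hbu : B (nb x t) (nb x cu)) (hbl : B (nb x t) (nb x cl)) :
    Pc (nb x t) = hcpInt ∧
      ∀ q ∈ Pc (nb x t), sqNormInt (q - zlab Pc nb (nb x t) (nb x cu)) = 18 →
        sqNormInt (q - zlab Pc nb (nb x t) (nb x cl)) = 18 → -q ∈ Pc (nb x t) := by
  have hy := nb_mem hch hx ht
  have hμ := zlab_spec hch hy.1 (nb_mem hch hx hcu).1 hbu
  have hlam := zlab_spec hch hy.1 (nb_mem hch hx hcl).1 hbl
  have D : sqNormInt (zlab Pc nb (nb x t) (nb x cu) - zlab Pc nb (nb x t) (nb x cl)) = 48 := by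
    rw [transfer_nb_nb hch hx hy.1 hy.2 hcu hcl hbu hbl, h48]
  have hPy : Pc (nb x t) = hcpInt := by
    rcases pattern_cases hch hy.1 with h | h
    · exfalso
      rw [h] at hμ hlam
      exact sqNormInt_sub_ne_48_of_fcc3Int _ hμ.1 _ hlam.1 D
    · exact h
  refine ⟨hPy, fun q hq h1 h2 => ?_⟩
  rw [hPy] at hq hμ hlam ⊢
  exact neg_mem_of_mirror_pair q hq _ hμ.1 _ hlam.1 h1 h2 D

omit hch in
/-! ## Registered anchor (closed form) -/

omit hch in
/-- **Closed form of `transfer_nb_target`** (the registered anchor of this file): the section data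
`S, B, Pc, nb` and the standing hypothesis written out (two hypotheses regrouped). [folklore] -/
theorem transfer_nb_target_graded :
    ∀ {S : ℕ → Set (EuclideanSpace ℝ (Fin 3))} {B : EuclideanSpace ℝ (Fin 3) → EuclideanSpace ℝ
    (Fin 3) → Prop} {Pc : EuclideanSpace ℝ (Fin 3) → Finset (Fin 3 → ℤ)} {nb : EuclideanSpace ℝ
    (Fin 3) → (Fin 3 → ℤ) → EuclideanSpace ℝ (Fin 3)}, ((∀ n : ℕ, ∀ z ∈ S n, (Pc z =
    Summit.AtomisticToContinuum.Crystallization.Theorems.PalmUnimodularRigidityShellsToBarlowChart.fcc3Int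
    ∨ Pc z = Literature.Geometry.DiscreteGeometry.hcpInt) ∧ Set.BijOn (nb z) (↑(Pc z) : Set (Fin
    3 → ℤ)) {y | B z y} ∧ ∀ t ∈ Pc z, ∀ t' ∈ Pc z, (B (nb z t) (nb z t') ↔
    Literature.Geometry.DiscreteGeometry.sqNormInt (t - t') = 18)) ∧ (∀ n : ℕ, ∀ z ∈ S (n + 1),
    ∀ y, B z y → y ∈ S n) ∧ (∀ n m : ℕ, ∀ x ∈ S n, ∀ y ∈ S m, B x y → ∀ (z z' : EuclideanSpace ℝ
    (Fin 3)) (t t' u u' : Fin 3 → ℤ), (t = 0 ∧ z = x ∨ t ∈ Pc x ∧ z = nb x t) → (t' = 0 ∧ z' = x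
    ∨ t' ∈ Pc x ∧ z' = nb x t') → (u = 0 ∧ z = y ∨ u ∈ Pc y ∧ z = nb y u) → (u' = 0 ∧ z' = y ∨
    u' ∈ Pc y ∧ z' = nb y u') → Literature.Geometry.DiscreteGeometry.sqNormInt (u - u') =
    Literature.Geometry.DiscreteGeometry.sqNormInt (t - t')) ∧ (∀ x y, B x y → B y x)) → ∀ {n :
    ℕ} {x : EuclideanSpace ℝ (Fin 3)} {t₀ t : Fin 3 → ℤ}, t₀ ∈ Pc x → x ∈ S (n + 1) → t ∈ Pc x →
    B (nb x t₀) (nb x t) → Literature.Geometry.DiscreteGeometry.sqNormInt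
    (Summit.AtomisticToContinuum.Crystallization.Theorems.PalmUnimodularRigidityShellsToBarlowChart.zlab
    Pc nb (nb x t₀) (nb x t)) = Literature.Geometry.DiscreteGeometry.sqNormInt (t - t₀) := by
  intro S B Pc nb hch n x t₀ t ht₀ hx ht hzt
  exact transfer_nb_target hch hx ht₀ ht hzt

end Summit.AtomisticToContinuum.Crystallization.Theorems.SquareWellLayerCakeGapTwelveToBarlow

end
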